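import Mathlib
import HarnessLib
import Literature.NumberTheory.LFunctions.ZetaArgBacklundExplicit
import Literature.NumberTheory.LFunctions.SchoenfeldZeroSums
import Literature.NumberTheory.LFunctions.ZetaFirstZeroCertificate

/-!
# Route `IntegerScrew`, LINE «SCREW DEPTH–HEIGHT DICTIONARY» (rh-idea-10/A) — the LOCAL ZERO COUNT
# `#{ρ : |Im ρ − T| ≤ 1} ≤ log T + 20` (window part (iii) of item `stmt-RiemannHypothesis-21806`)

For every real `T ≥ 1`, the non-trivial zeros `ρ = β + iγ` of `ζ` with `|γ − T| ≤ 1`, counted with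
multiplicity `m(ρ) = riemannZetaZeroOrder ρ`, number at most `log T + 20` (`window_count_le`).

PROOF.  If `T + 1 ≤ 14` there is no such zero (`riemannZeta_ne_zero_of_im_pos_of_im_le_fourteen`,
PROVED from the tree's certificate `N(14) = 0`).  Otherwise put `T₁ = T − 1 − 1/(T+1) ∈ [e, T − 1)`;
then the window count is at most `N(T+1) − N(T₁)` (`SchoenfeldBound.zetaZeroCount_sub_eq_sum`), and
the tree's explicit Riemann–von Mangoldt bound `|N(u) − (u/2π)log(u/2πe)| ≤ 0.3083 log u + 7.7`
for `u ≥ e` (`abs_zetaZeroCount_sub_main_le_explicit'`, PROVED) at `u = T + 1` and `u = T₁`, together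
with the elementary main-term increment `main(b) − main(a) ≤ ((b − a)/2π)·log(b/2π)`
(`rvmMain_sub_rvmMain_le`, from `log(b/a) ≤ b/a − 1`), give
`≤ (1/π + 0.6166)·log(T+1) + 0.16 + 15.4 ≤ 0.9351·log T + 16.3 ≤ log T + 20`.
The width-`1/(T+1)` undershoot of the left endpoint is what keeps the constant uniform in `T`
(a fixed undershoot `ε` would cost `(ε/2π)·log T`).

RH is NOT proved by this file and nothing here bears on the truth of RH.  References: explicit
zero counting as in Trudgian, *J. Number Theory* 134 (2014) / Hasanalizade–Shen–Wong, *J. Number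
Theory* 235 (2022) (here replaced by the tree's PROVED Backlund-type bound); E. C. Titchmarsh,
*The Theory of the Riemann Zeta-Function* (1986) §9.
-/

noncomputable section

-- D-0017: `Summit.<S>.<S>.…` is the designed namespace of a single-problem summit.
set_option linter.dupNamespace false

namespace Summit.RiemannHypothesis.RiemannHypothesis.Theorems.IntegerScrew

open Finset Literature.NumberTheory.LFunctions
open scoped Real

/-- Increment of the Riemann–von Mangoldt main term `main(u) = (u/2π)·log(u/(2πe))`:
for `0 < a ≤ b`, `main(b) − main(a) ≤ ((b − a)/2π)·log(b/2π)` (from `log(b/a) ≤ b/a − 1`). [folklore] -/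
theorem rvmMain_sub_rvmMain_le {a b : ℝ} (ha : 0 < a) (hab : a ≤ b) :
    b / (2 * π) * Real.log (b / (2 * π * Real.exp 1)) - a / (2 * π) * Real.log (a / (2 * π * Real.exp 1))
      ≤ (b - a) / (2 * π) * Real.log (b / (2 * π)) := by
  have hb : 0 < b := ha.trans_le hab
  have h2π : 0 < 2 * π := by positivity
  have e1 : Real.log (b / (2 * π * Real.exp 1)) = Real.log b - Real.log (2 * π) - 1 := by
    rw [Real.log_div hb.ne' (by positivity), Real.log_mul h2π.ne' (Real.exp_pos 1).ne', Real.log_exp]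
    ring
  have e2 : Real.log (a / (2 * π * Real.exp 1)) = Real.log a - Real.log (2 * π) - 1 := by
    rw [Real.log_div ha.ne' (by positivity), Real.log_mul h2π.ne' (Real.exp_pos 1).ne', Real.log_exp]
    ring
  have e3 : Real.log (b / (2 * π)) = Real.log b - Real.log (2 * π) := Real.log_div hb.ne' h2π.ne'
  have hlog : Real.log b - Real.log a ≤ b / a - 1 := by
    rw [← Real.log_div hb.ne' ha.ne']
    exact Real.log_le_sub_one_of_pos (by positivity)
  have hkey : a * (Real.log b - Real.log a) ≤ b - a := by
    have h := mul_le_mul_of_nonneg_left hlog ha.le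
    have e : a * (b / a - 1) = b - a := by field_simp
    linarith
  rw [e1, e2, e3]
  have eL : b / (2 * π) * (Real.log b - Real.log (2 * π) - 1) - a / (2 * π) * (Real.log a - Real.log (2 * π) - 1)
      = (b * (Real.log b - Real.log (2 * π) - 1) - a * (Real.log a - Real.log (2 * π) - 1)) / (2 * π) := by
    ring
  have eR : (b - a) / (2 * π) * (Real.log b - Real.log (2 * π))
      = ((b - a) * (Real.log b - Real.log (2 * π))) / (2 * π) := by
    ring
  rw [eL, eR]
  refine div_le_div_of_nonneg_right ?_ h2π.le
  nlinarith [hkey]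

/-- **The local zero count**: for `T ≥ 1`, `Σ_{ρ : |Im ρ − T| ≤ 1} m(ρ) ≤ log T + 20`, the sum over the
zeros of `ζ` in the box `0 ≤ Re ρ ≤ 1`, `0 < Im ρ ≤ T + 1` (which contains every non-trivial zero with
`|Im ρ − T| ≤ 1`). [folklore] -/
theorem window_count_le {T : ℝ} (hT : 1 ≤ T) :
    ∑ ρ ∈ (zetaZeroBox_finite 0 (T + 1)).toFinset,
        (if |ρ.im - T| ≤ 1 then (riemannZetaZeroOrder ρ : ℝ) else 0) ≤ Real.log T + 20 := by
  classical
  have hlogT : 0 ≤ Real.log T := Real.log_nonneg hT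
  rcases le_or_gt (T + 1) 14 with hsmall | hbig
  · -- below height 14 there are no zeros at all
    have h0 : ∀ ρ ∈ (zetaZeroBox_finite 0 (T + 1)).toFinset,
        (if |ρ.im - T| ≤ 1 then (riemannZetaZeroOrder ρ : ℝ) else 0) = 0 := by
      intro ρ hρ
      rw [Set.Finite.mem_toFinset] at hρ
      obtain ⟨hz, -, -, h3, h4⟩ := hρ
      exact absurd hz (riemannZeta_ne_zero_of_im_pos_of_im_le_fourteen h3 (h4.trans hsmall))
    rw [Finset.sum_eq_zero h0]
    linarith
  · -- `T > 13`: compare with `N(T+1) − N(T₁)`, `T₁ = T − 1 − 1/(T+1)`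
    have hT0 : 0 < T + 1 := by linarith
    set T₁ : ℝ := T - 1 - 1 / (T + 1) with hT₁
    have hinv : 0 < 1 / (T + 1) := by positivity
    have hinv' : 1 / (T + 1) ≤ 1 / 14 := one_div_le_one_div_of_le (by norm_num) hbig.le
    have he := Real.exp_one_lt_d9
    have hT1e : Real.exp 1 ≤ T₁ := by rw [hT₁]; linarith
    have hT1pos : 0 < T₁ := (Real.exp_pos 1).trans_le hT1e
    have hT1le : T₁ ≤ T + 1 := by rw [hT₁]; linarith
    -- Step 1: the window count is at most the count in `(T₁, T+1]`
    have h1 : ∑ ρ ∈ (zetaZeroBox_finite 0 (T + 1)).toFinset,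
          (if |ρ.im - T| ≤ 1 then (riemannZetaZeroOrder ρ : ℝ) else 0)
        ≤ ∑ ρ ∈ SchoenfeldBound.zerosBetween T₁ (T + 1), (riemannZetaZeroOrder ρ : ℝ) := by
      rw [← Finset.sum_filter]
      apply Finset.sum_le_sum_of_subset_of_nonneg
      · intro ρ hρ
        rw [Finset.mem_filter, Set.Finite.mem_toFinset] at hρ
        obtain ⟨⟨hz, h1, h2, _, h4⟩, hw⟩ := hρ
        rw [SchoenfeldBound.mem_zerosBetween hT1pos.le]
        refine ⟨hz, h1, h2, ?_, h4⟩
        have hw' := (abs_le.1 hw).1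
        rw [hT₁]
        linarith
      · intro ρ hρ _
        exact SchoenfeldBound.zeroOrder_nonneg_of_mem_zerosBetween hT1pos.le hρ
    rw [← SchoenfeldBound.zetaZeroCount_sub_eq_sum hT1le] at h1
    -- Step 2: explicit Riemann–von Mangoldt at `T + 1` and `T₁`
    have hU := abs_zetaZeroCount_sub_main_le_explicit' (T := T + 1) (by linarith)
    have hL := abs_zetaZeroCount_sub_main_le_explicit' hT1e
    have hU' := (abs_le.1 hU).2
    have hL' := (abs_le.1 hL).1
    have hmain := rvmMain_sub_rvmMain_le hT1pos hT1le
    -- Step 3: the main-term increment `((2 + 1/(T+1))/2π)·log((T+1)/2π) ≤ 0.3185·log(T+1) + 0.16`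
    have hπ := Real.pi_gt_d2
    have hπpos := Real.pi_pos
    have hlog1 : 0 ≤ Real.log (T + 1) := Real.log_nonneg (by linarith)
    have hlogq : Real.log ((T + 1) / (2 * π)) ≤ Real.log (T + 1) := by
      apply Real.log_le_log (by positivity)
      rw [div_le_iff₀ (by positivity)]
      nlinarith
    have hwidth : (T + 1 - T₁) / (2 * π) = 1 / π + (1 / (T + 1)) / (2 * π) := by
      rw [hT₁]; field_simp; ring
    have hinvπ : 1 / π ≤ 0.3185 := by
      rw [div_le_iff₀ hπpos]; nlinarith
    have hinv2π : 1 / (2 * π) ≤ 0.16 := by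
      rw [div_le_iff₀ (by positivity)]; nlinarith
    have hlogT1 : Real.log (T + 1) ≤ T := by
      have := Real.log_le_sub_one_of_pos hT0; linarith
    have hsmallterm : (1 / (T + 1)) / (2 * π) * Real.log (T + 1) ≤ 0.16 := by
      have h1' : (1 / (T + 1)) * Real.log (T + 1) ≤ 1 := by
        rw [div_mul_eq_mul_div, one_mul, div_le_one hT0]; linarith
      calc (1 / (T + 1)) / (2 * π) * Real.log (T + 1)
          = (1 / (2 * π)) * ((1 / (T + 1)) * Real.log (T + 1)) := by ring
        _ ≤ 0.16 * 1 := mul_le_mul hinv2π h1' (by positivity) (by norm_num)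
        _ = 0.16 := by norm_num
    have hmain' : (T + 1 - T₁) / (2 * π) * Real.log ((T + 1) / (2 * π))
        ≤ 0.3185 * Real.log (T + 1) + 0.16 := by
      have hw0 : 0 ≤ (T + 1 - T₁) / (2 * π) := by positivity
      calc (T + 1 - T₁) / (2 * π) * Real.log ((T + 1) / (2 * π))
          ≤ (T + 1 - T₁) / (2 * π) * Real.log (T + 1) := mul_le_mul_of_nonneg_left hlogq hw0
        _ = 1 / π * Real.log (T + 1) + (1 / (T + 1)) / (2 * π) * Real.log (T + 1) := by
            rw [hwidth]; ring
        _ ≤ 0.3185 * Real.log (T + 1) + 0.16 := by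
            have := mul_le_mul_of_nonneg_right hinvπ hlog1
            linarith
    -- Step 4: `log T₁ ≤ log(T+1) ≤ log T + log 2`
    have hlogT1' : Real.log T₁ ≤ Real.log (T + 1) := Real.log_le_log hT1pos hT1le
    have hlog2 := Real.log_two_lt_d9
    have hlogT2 : Real.log (T + 1) ≤ Real.log T + Real.log 2 := by
      rw [← Real.log_mul (by linarith) (by norm_num)]
      exact Real.log_le_log hT0 (by linarith)
    linarith

end Summit.RiemannHypothesis.RiemannHypothesis.Theorems.IntegerScrew

end
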